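import Mathlib
import HarnessLib

/-!
# Certificate glue, XXX: THE SECTION NODE — projecting a parallelepiped node along a boxed flow increment onto a quadratic section
  (helper for items stmt-NavierStokesRegularity-22987 `FlatGapCertificatesV2` (crux K_A♭ of route TaoLadderRungTwoFlat) and stmt-24295 K_A₂(64);
  cell harvest/h2-tao-ladder, p1 g15; theory-1 g25 F-28 and E3 v0.2 REPORT §3 «LEMMA XXIII (SectionNodeOn)», bus l.544)

Pure linear algebra on `Fin n → ℝ` (no cascade objects). Section functional `sec_q(z) = ½ Σ_j q_j z_j²` (diagonal weights `q`), a point `p`,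
a direction `f` with `d := Σ_j q_j p_j f_j > 0` (`ĝ := (q_j p_j)_j` is the gradient of `sec_q` at `p`), the oblique projection
`Π v := v − f (ĝ·v)/d` along `f` onto `ĝ^⊥`. If `z = y₀ + δ` with `y₀ = x̄ + Cξ + e` (`|ξ| ≤ r`, `|e_c| ≤ E_c`), a flow increment
`δ_c ∈ u·[Flo_c, Fhi_c]` (`0 ≤ u ≤ Δ`, `|Fhi_c − f_c|, |f_c − Flo_c| ≤ Φ_c`), `sec_q(z) = lev` and `|z_j − p_j| ≤ W_j`, then
`z = x* + C*ξ + e*` with the SAME `ξ`, where `x* = p − f (sec_q p − lev)/d + Π(x̄ − p)`, `C* = ΠC`, and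
`|e*_c| ≤ E*_c := (E_c + κ_c Σ_j|ĝ_j|E_j) + Δ(Φ_c + κ_c Σ_j|ĝ_j|Φ_j) + κ_c·qmax(W)`, `κ_c ≥ |f_c|/d`,
`qmax(W) = max(½ Σ_j (q_j)⁺ W_j², ½ Σ_j (q_j)⁻ W_j²)` (`sectionNode`); plus the box hull `|z_c − x*_c| ≤ Σ_col |C*_{c,col}| r_col + E*_c`
(`sectionNode_box`). The flow increment hypothesis is the mean-value enclosure of glue `picard_level` read in weighted coordinates (successor wrapper).

HONEST FRAMING: elementary algebra serving a checker of Tao-type MODEL lattice certificates; NO certificate instance exists in the tree, nothing is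
certified here, no stub is closed, nothing here is a statement about the Navier–Stokes equations.
-/

-- the sub-problem namespace repeats the summit name by design (D-0017)
set_option linter.dupNamespace false

namespace Summit.NavierStokesRegularity.NavierStokesRegularity.Theorems

open Set Finset

namespace CertificateGlueOn

noncomputable section

variable {n : ℕ}

/-! ### The section data -/

/-- The quadratic section functional `sec_q(z) = ½ Σ_j q_j z_j²`. [folklore] -/
def secQ (q z : Fin n → ℝ) : ℝ := (1 / 2) * ∑ j, q j * z j ^ 2

/-- Its gradient at `p`: `ĝ_j = q_j p_j`. [folklore] -/
def secGrad (q p : Fin n → ℝ) : Fin n → ℝ := fun j => q j * p j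

/-- The pairing `ĝ·v`. [folklore] -/
def secPair (q p v : Fin n → ℝ) : ℝ := ∑ j, secGrad q p j * v j

/-- The transversality denominator `d = ĝ·f`. [folklore] -/
def secD (q p f : Fin n → ℝ) : ℝ := secPair q p f

/-- The oblique projection along `f` onto the tangent hyperplane: `Π v = v − f (ĝ·v)/d`. [folklore] -/
def secProj (q p f v : Fin n → ℝ) : Fin n → ℝ := fun c => v c - f c * secPair q p v / secD q p f

/-- The section-node centre `x* = p − f (sec_q p − lev)/d + Π(x̄ − p)`. [folklore] -/
def secCentre (q p f xb : Fin n → ℝ) (lev : ℝ) : Fin n → ℝ :=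
  fun c => p c - f c * (secQ q p - lev) / secD q p f + secProj q p f (xb - p) c

/-- The section-node frame `C* = ΠC` (column-wise). [folklore] -/
def secFrame (q p f : Fin n → ℝ) (C : Matrix (Fin n) (Fin n) ℝ) : Matrix (Fin n) (Fin n) ℝ :=
  fun c col => C c col - f c * (∑ j, secGrad q p j * C j col) / secD q p f

/-- The quadratic remainder bound `qmax(W) = max(½ Σ (q_j)⁺ W_j², ½ Σ (q_j)⁻ W_j²)`. [folklore] -/
def secQmax (q W : Fin n → ℝ) : ℝ :=
  max ((1 / 2) * ∑ j, max (q j) 0 * W j ^ 2) ((1 / 2) * ∑ j, max (-q j) 0 * W j ^ 2)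

/-- The section-node remainder radius `E*_c = (E_c + κ_c Σ|ĝ_j|E_j) + Δ(Φ_c + κ_c Σ|ĝ_j|Φ_j) + κ_c·qm`. [folklore] -/
def secErr (q p κ E Φ : Fin n → ℝ) (Δ qm : ℝ) : Fin n → ℝ := fun c =>
  (E c + κ c * ∑ j, |secGrad q p j| * E j) + Δ * (Φ c + κ c * ∑ j, |secGrad q p j| * Φ j) + κ c * qm

/-! ### Algebra -/

/-- Second-order expansion of the section functional: `sec(p + v) = sec p + ĝ·v + ½ Σ q_j v_j²`. [folklore] -/
theorem secQ_add (q p v : Fin n → ℝ) :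
    secQ q (p + v) = secQ q p + secPair q p v + (1 / 2) * ∑ j, q j * v j ^ 2 := by
  simp only [secQ, secPair, secGrad, Pi.add_apply, Finset.mul_sum, ← Finset.sum_add_distrib]
  exact Finset.sum_congr rfl fun j _ => by ring

/-- The pairing is additive. [folklore] -/
theorem secPair_add (q p v w : Fin n → ℝ) : secPair q p (v + w) = secPair q p v + secPair q p w := by
  simp only [secPair, Pi.add_apply, mul_add, Finset.sum_add_distrib]

/-- The pairing is compatible with subtraction. [folklore] -/
theorem secPair_sub (q p v w : Fin n → ℝ) : secPair q p (v - w) = secPair q p v - secPair q p w := by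
  simp only [secPair, Pi.sub_apply, mul_sub, Finset.sum_sub_distrib]

/-- The pairing is homogeneous. [folklore] -/
theorem secPair_smul (q p v : Fin n → ℝ) (u : ℝ) : secPair q p (u • v) = u * secPair q p v := by
  simp only [secPair, Pi.smul_apply, smul_eq_mul, Finset.mul_sum]
  exact Finset.sum_congr rfl fun j _ => by ring

/-- The pairing with a matrix image: `ĝ·(Cξ) = Σ_col (ĝ·C_col) ξ_col`. [folklore] -/
theorem secPair_mulVec (q p : Fin n → ℝ) (C : Matrix (Fin n) (Fin n) ℝ) (ξ : Fin n → ℝ) :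
    secPair q p (C.mulVec ξ) = ∑ col, (∑ j, secGrad q p j * C j col) * ξ col := by
  simp only [secPair, Matrix.mulVec, dotProduct, Finset.mul_sum, Finset.sum_mul]
  conv_lhs => rw [Finset.sum_comm]
  exact Finset.sum_congr rfl fun col _ => Finset.sum_congr rfl fun j _ => by ring

/-- The section frame acts as `C` followed by the projection: `(C*ξ)_c = (Cξ)_c − f_c (ĝ·Cξ)/d`. [folklore] -/
theorem secFrame_mulVec (q p f : Fin n → ℝ) (C : Matrix (Fin n) (Fin n) ℝ) (ξ : Fin n → ℝ) (c : Fin n) :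
    (secFrame q p f C).mulVec ξ c = C.mulVec ξ c - f c * secPair q p (C.mulVec ξ) / secD q p f := by
  rw [secPair_mulVec]
  simp only [secFrame, Matrix.mulVec, dotProduct]
  have h : ∀ col, (C c col - f c * (∑ j, secGrad q p j * C j col) / secD q p f) * ξ col =
      C c col * ξ col - (f c / secD q p f) * ((∑ j, secGrad q p j * C j col) * ξ col) := fun col => by ring
  simp only [h, Finset.sum_sub_distrib, ← Finset.mul_sum]
  ring

/-- The absolute pairing bound `|ĝ·w| ≤ Σ|ĝ_j||w_j|`. [folklore] -/
theorem abs_secPair_le (q p w : Fin n → ℝ) : |secPair q p w| ≤ ∑ j, |secGrad q p j| * |w j| := by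
  unfold secPair
  refine (Finset.abs_sum_le_sum_abs _ _).trans (le_of_eq (Finset.sum_congr rfl fun j _ => abs_mul _ _))

/-- **Row bound of the projection**: `|(Πw)_c| ≤ |w_c| + κ_c Σ_j|ĝ_j||w_j|` for `κ_c ≥ |f_c|/d`. [folklore] -/
theorem abs_secProj_le {q p f κ : Fin n → ℝ} (hd : 0 < secD q p f) (hκ : ∀ c, |f c| ≤ κ c * secD q p f)
    (w : Fin n → ℝ) (c : Fin n) :
    |secProj q p f w c| ≤ |w c| + κ c * ∑ j, |secGrad q p j| * |w j| := by
  unfold secProj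
  refine (abs_sub _ _).trans (add_le_add le_rfl ?_)
  rw [abs_div, abs_mul, abs_of_pos hd]
  have hS := abs_secPair_le q p w
  have hS0 : 0 ≤ |secPair q p w| := abs_nonneg _
  calc |f c| * |secPair q p w| / secD q p f
      ≤ κ c * secD q p f * |secPair q p w| / secD q p f :=
        div_le_div_of_nonneg_right (mul_le_mul_of_nonneg_right (hκ c) hS0) hd.le
    _ = κ c * |secPair q p w| := by field_simp
    _ ≤ κ c * ∑ j, |secGrad q p j| * |w j| := by
        have hκ0 : 0 ≤ κ c := by
          have h1 := (abs_nonneg (f c)).trans (hκ c)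
          exact nonneg_of_mul_nonneg_left h1 hd
        exact mul_le_mul_of_nonneg_left hS hκ0

/-- **The quadratic remainder on a box**: `|½ Σ q_j v_j²| ≤ qmax(W)` for `|v_j| ≤ W_j`. [folklore] -/
theorem abs_quad_le_secQmax {q W v : Fin n → ℝ} (hW : ∀ j, |v j| ≤ W j) :
    |(1 / 2) * ∑ j, q j * v j ^ 2| ≤ secQmax q W := by
  have hsq : ∀ j, v j ^ 2 ≤ W j ^ 2 := fun j => by
    have h := hW j
    have h0 : 0 ≤ W j := (abs_nonneg _).trans h
    nlinarith [abs_nonneg (v j), sq_abs (v j)]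
  have hup : ∑ j, q j * v j ^ 2 ≤ ∑ j, max (q j) 0 * W j ^ 2 := Finset.sum_le_sum fun j _ => by
    have h1 : q j * v j ^ 2 ≤ max (q j) 0 * v j ^ 2 := mul_le_mul_of_nonneg_right (le_max_left _ _) (sq_nonneg _)
    exact h1.trans (mul_le_mul_of_nonneg_left (hsq j) (le_max_right _ _))
  have hlo : -(∑ j, max (-q j) 0 * W j ^ 2) ≤ ∑ j, q j * v j ^ 2 := by
    rw [← Finset.sum_neg_distrib]
    refine Finset.sum_le_sum fun j _ => ?_
    have h1 : -(max (-q j) 0) * v j ^ 2 ≤ q j * v j ^ 2 :=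
      mul_le_mul_of_nonneg_right (by have := le_max_left (-q j) 0; linarith) (sq_nonneg _)
    have h2 : max (-q j) 0 * v j ^ 2 ≤ max (-q j) 0 * W j ^ 2 := mul_le_mul_of_nonneg_left (hsq j) (le_max_right _ _)
    linarith
  unfold secQmax
  rw [abs_le]
  constructor
  · have := le_max_right ((1 / 2) * ∑ j, max (q j) 0 * W j ^ 2) ((1 / 2) * ∑ j, max (-q j) 0 * W j ^ 2)
    linarith
  · have := le_max_left ((1 / 2) * ∑ j, max (q j) 0 * W j ^ 2) ((1 / 2) * ∑ j, max (-q j) 0 * W j ^ 2)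
    linarith

/-- The scalar bookkeeping identity behind `sectionNode` (all pairings abstracted to scalars). [folklore] -/
theorem sectionNode_identity {pc vc xc Cc ec δc fc u I d sp lev G1 G2 G3 G4 Gd Gv qq : ℝ}
    (hvc : vc = (xc - pc) + Cc + ec + δc) (hGv : G1 + G2 + G3 + Gd = Gv) (hG4 : G4 = Gd - u * d)
    (hsec : sp - lev + Gv + qq = 0) (hId : I * d = 1) :
    pc + vc = (pc - fc * (sp - lev) * I + ((xc - pc) - fc * G1 * I)) + (Cc - fc * G2 * I) +
      ((ec - fc * G3 * I) + ((δc - u * fc) - fc * G4 * I) - fc * qq * I) := by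
  linear_combination hvc + (fc * I) * hGv + (fc * I) * hG4 + (fc * I) * hsec + (-(u * fc)) * hId

/-! ### The section node -/

/-- **THE SECTION NODE** (theory-1 E3 v0.2 §3, LEMMA «SectionNodeOn»): a parallelepiped node `x̄ + Cξ + e` moved by a boxed flow increment
`δ ∈ u·[Flo, Fhi]`, `0 ≤ u ≤ Δ`, and read ON the section `{sec_q = lev}` lies in the parallelepiped `x* + C*ξ + e*` with the same `ξ` and
`|e*_c| ≤ E*_c`. [cite: Zgliczynski2002C1Lohner, §3–4 (Lohner-type parallelepiped sets; affine images and section maps); cell certificate format, section node] -/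
theorem sectionNode {q p f xb κ E Flo Fhi Φ W : Fin n → ℝ} {C : Matrix (Fin n) (Fin n) ℝ} {Δ lev u : ℝ}
    {ξ e y₀ z : Fin n → ℝ}
    (hd : 0 < secD q p f) (hκ : ∀ c, |f c| ≤ κ c * secD q p f)
    (hy₀ : y₀ = xb + (C.mulVec ξ + e)) (he : ∀ c, |e c| ≤ E c)
    (hu : u ∈ Icc 0 Δ) (hδ : ∀ c, u * Flo c ≤ z c - y₀ c ∧ z c - y₀ c ≤ u * Fhi c) (hF : ∀ c, Flo c ≤ Fhi c)
    (hΦ : ∀ c, Fhi c - f c ≤ Φ c ∧ f c - Flo c ≤ Φ c)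
    (hsec : secQ q z = lev) (hW : ∀ j, |z j - p j| ≤ W j) :
    ∃ es : Fin n → ℝ, (∀ c, |es c| ≤ secErr q p κ E Φ Δ (secQmax q W) c) ∧
      z = secCentre q p f xb lev + ((secFrame q p f C).mulVec ξ + es) := by
  set d := secD q p f with hd_def
  set v : Fin n → ℝ := z - p with hv
  set δ : Fin n → ℝ := z - y₀ with hδdef
  set w : Fin n → ℝ := δ - u • f with hw
  set qq : ℝ := (1 / 2) * ∑ j, q j * v j ^ 2 with hqq
  -- the remainder
  set es : Fin n → ℝ := fun c => secProj q p f e c + secProj q p f w c - f c * qq / d with hes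
  -- scalar facts
  have hGf : secPair q p f = d := rfl
  have hsec' : secQ q p - lev + secPair q p v + qq = 0 := by
    have h := secQ_add q p v
    have hz : p + v = z := by simp [hv]
    rw [hz, hsec] at h
    linarith
  have hvsum : v = (xb - p) + C.mulVec ξ + e + δ := by
    simp only [hv, hδdef, hy₀]; abel
  have hGv : secPair q p (xb - p) + secPair q p (C.mulVec ξ) + secPair q p e + secPair q p δ = secPair q p v := by
    rw [hvsum, secPair_add, secPair_add, secPair_add]
  have hG4 : secPair q p w = secPair q p δ - u * d := by
    rw [hw, secPair_sub, secPair_smul, hGf]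
  have hId : d⁻¹ * d = 1 := inv_mul_cancel₀ hd.ne'
  refine ⟨es, fun c => ?_, ?_⟩
  · -- the bound
    have hw_c : ∀ c, |w c| ≤ Δ * Φ c := by
      intro c
      have h1 := hδ c
      have h2 := hΦ c
      simp only [hw, hδdef, Pi.sub_apply, Pi.smul_apply, smul_eq_mul]
      rw [abs_le]
      have hΦ0 : 0 ≤ Φ c := by linarith [h2.1, h2.2, hF c]
      have a1 := mul_le_mul_of_nonneg_left h2.1 hu.1
      have a2 := mul_le_mul_of_nonneg_left h2.2 hu.1
      have a3 : u * Φ c ≤ Δ * Φ c := mul_le_mul_of_nonneg_right hu.2 hΦ0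
      rw [mul_sub] at a1 a2
      constructor <;> linarith [h1.1, h1.2]
    have hPe := abs_secProj_le hd hκ e c
    have hPw := abs_secProj_le hd hκ w c
    have hκ0 : 0 ≤ κ c := by
      have := (abs_nonneg (f c)).trans (hκ c); nlinarith [hd]
    have hg0 : ∀ j, 0 ≤ |secGrad q p j| := fun j => abs_nonneg _
    have hq3 : |f c * qq / d| ≤ κ c * secQmax q W := by
      rw [abs_div, abs_mul, abs_of_pos hd]
      have hqq := abs_quad_le_secQmax (q := q) (v := v) hW
      calc |f c| * |qq| / d ≤ κ c * d * |qq| / d :=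
            div_le_div_of_nonneg_right (mul_le_mul_of_nonneg_right (hκ c) (abs_nonneg _)) hd.le
        _ = κ c * |qq| := by field_simp
        _ ≤ κ c * secQmax q W := mul_le_mul_of_nonneg_left hqq hκ0
    have hsumE : ∑ j, |secGrad q p j| * |e j| ≤ ∑ j, |secGrad q p j| * E j :=
      Finset.sum_le_sum fun j _ => mul_le_mul_of_nonneg_left (he j) (hg0 j)
    have hsumW : ∑ j, |secGrad q p j| * |w j| ≤ Δ * ∑ j, |secGrad q p j| * Φ j := by
      rw [Finset.mul_sum]
      exact Finset.sum_le_sum fun j _ => by nlinarith [hw_c j, hg0 j]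
    have h3 : |es c| ≤ |secProj q p f e c| + |secProj q p f w c| + |f c * qq / d| := by
      simp only [hes]; exact (abs_sub _ _).trans (add_le_add (abs_add_le _ _) le_rfl)
    simp only [secErr]
    nlinarith [h3, hPe, hPw, hq3, he c, hw_c c, hsumE, hsumW, mul_le_mul_of_nonneg_left hsumE hκ0,
      mul_le_mul_of_nonneg_left hsumW hκ0]
  · -- the identity, coordinatewise
    funext c
    simp only [Pi.add_apply]
    rw [secFrame_mulVec]
    have hzc : z c = p c + v c := by simp [hv]
    have hvc : v c = (xb c - p c) + C.mulVec ξ c + e c + δ c := by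
      have := congrArg (fun g => g c) hvsum; simpa using this
    have hwc : w c = δ c - u * f c := by simp [hw]
    rw [hzc]
    simp only [secCentre, secProj, hes, Pi.sub_apply, hwc, div_eq_mul_inv, ← hd_def]
    have key := sectionNode_identity (pc := p c) (xc := xb c) (Cc := C.mulVec ξ c) (ec := e c) (fc := f c)
      (I := d⁻¹) (sp := secQ q p) (lev := lev) (qq := qq) hvc hGv hG4 hsec' hId
    -- `key` matches the goal up to the placement of `d⁻¹`
    have e1 : secPair q p (xb - p) = secPair q p (xb - p) := rfl
    linear_combination key

/-- **Box hull of the section node**: `|z_c − x*_c| ≤ Σ_col |C*_{c,col}| r_col + E*_c`. [folklore] -/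
theorem sectionNode_box {q p f xb κ E Flo Fhi Φ W r : Fin n → ℝ} {C : Matrix (Fin n) (Fin n) ℝ} {Δ lev u : ℝ}
    {ξ e y₀ z : Fin n → ℝ}
    (hd : 0 < secD q p f) (hκ : ∀ c, |f c| ≤ κ c * secD q p f)
    (hy₀ : y₀ = xb + (C.mulVec ξ + e)) (hξ : ∀ c, |ξ c| ≤ r c) (he : ∀ c, |e c| ≤ E c)
    (hu : u ∈ Icc 0 Δ) (hδ : ∀ c, u * Flo c ≤ z c - y₀ c ∧ z c - y₀ c ≤ u * Fhi c) (hF : ∀ c, Flo c ≤ Fhi c)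
    (hΦ : ∀ c, Fhi c - f c ≤ Φ c ∧ f c - Flo c ≤ Φ c)
    (hsec : secQ q z = lev) (hW : ∀ j, |z j - p j| ≤ W j) (c : Fin n) :
    |z c - secCentre q p f xb lev c| ≤ ∑ col, |secFrame q p f C c col| * r col + secErr q p κ E Φ Δ (secQmax q W) c := by
  obtain ⟨es, hes, hz⟩ := sectionNode hd hκ hy₀ he hu hδ hF hΦ hsec hW
  have hzc : z c - secCentre q p f xb lev c = (secFrame q p f C).mulVec ξ c + es c := by
    have := congrArg (fun g => g c) hz
    simp only [Pi.add_apply] at this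
    linarith
  rw [hzc]
  refine (abs_add_le _ _).trans (add_le_add ?_ (hes c))
  simp only [Matrix.mulVec, dotProduct]
  refine (Finset.abs_sum_le_sum_abs _ _).trans (Finset.sum_le_sum fun col _ => ?_)
  rw [abs_mul]
  exact mul_le_mul_of_nonneg_left (hξ col) (abs_nonneg _)

end

end CertificateGlueOn

end Summit.NavierStokesRegularity.NavierStokesRegularity.Theorems
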